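import Mathlib
import HarnessLib
import Summits.HubbardSuperconductivity.HubbardSuperconductivity.Theorems.KLProgrammeKLRegimeVolumeLimitTwoPointTimeH1OfC2
import Literature.MathematicalPhysics.QuantumLattice.ShiftedHubbardTwoTimeDeterminant

/-!
# Child `KLRegimeVolumeLimitV14` (stmt-HubbardSuperconductivity-19921), `stub_vl_bound`: (H1) — THE τ-RESOLVED TWO-POINT IDENTIFICATION,
# UNCONDITIONAL: discharge of the pointwise hypothesis `hC2` of `…TwoPointTimeH1OfC2` from k3c5-p1's split-pair thermal Wick determinant
# (seat hubbard-kl-k3c4-p2, g3; «Matsubara all-U route (R-a)»)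

k3c5-p1's `gibbsState_dGamma_twoTime_shiftedHubbardWord_eq_neg_det` (p490677) writes the free expectation of p484918's two-time word as
`−det(splitPairMatrix(2k, 2k+2j) F G − diag(0,½,…,½))`, rows `(X, pairs)`, columns `(Y, pairs)`, pairs listed block by block; the before-rule
matrix `Ẽ` of `…TwoPointTimeMatch` lists the same pairs through `finProdFinEquiv` on `Fin (k+j) × Fin 2` with sites `f ⧺ f′`.  Here:
* `det_splitPairMatrix_sub_diagonal_eq_det_beforeRule` — the two determinants agree (a `Fin.cast` reindexing, `Matrix.det_submatrix_equiv_self`;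
  entries by k3c5-p1's closed forms `splitPairMatrix_evolved_*` against t2's `vacuumWordMatrix`/`propMatrix`);
* `trace_twoTimeWord_eq_partitionFn_mul_neg_det` — `hC2` for every configuration;
* **`hasSum_twoPointLimitDet_series_time`**, **`tendsto_twoPoint_hamiltonian`** — (H1) with no hypothesis left: for `L ≥ 3`, `β > 0`, every real
  `U, μ`, spins `σ, σ′`, sites `x, y`, `s ∈ (0,β)`,
  `∫dμ_{C_M} ψ⁺_{(x,s)σ}ψ⁻_{(y,0)σ′}e^{−V} ⟶ e^{−βUL²/4}·Tr(e^{−(β−s)H′}c†_{x̄σ}e^{−sH′}c_{ȳσ′})/Tr e^{−βH₀}` (`M → ∞`) — the hypothesis `hH1` of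
  k3c5-p2's `stub_vl_bound_of_H1` / `stub_vl_bound_V14_of_H1`, clause by clause.
Everything is proved; no definition.
-/

noncomputable section

namespace Summit.HubbardSuperconductivity.HubbardSuperconductivity.Theorems.MatsubaraAllU

set_option linter.dupNamespace false -- summit = problem name (single-conjunct summit), D-0017

open MeasureTheory Finset NormedSpace Filter Topology Literature.MathematicalPhysics.QuantumLattice Literature.Probability.LatticeModels
open scoped Nat ComplexOrder

/-! ## Index bookkeeping: block-by-block pair lists versus `finProdFinEquiv` on `Fin (k+j) × Fin 2` -/

/-- Appending the two blocks of pair data and reading at the cast index = reading the pair datum of the appended site list. -/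
theorem append_pairBlocks_cast {α γ : Type*} {k j : ℕ} (g : Fin k → γ) (g' : Fin j → γ) (Φ : γ → Fin 2 → α)
    (h : (k + j) * 2 = k * 2 + j * 2) (m : Fin ((k + j) * 2)) :
    Fin.append (fun i : Fin (k * 2) => Φ (g (finProdFinEquiv.symm i).1) (finProdFinEquiv.symm i).2)
        (fun i : Fin (j * 2) => Φ (g' (finProdFinEquiv.symm i).1) (finProdFinEquiv.symm i).2) (Fin.cast h m) =
      Φ (Fin.append g g' (finProdFinEquiv.symm m).1) (finProdFinEquiv.symm m).2 := by
  obtain ⟨⟨a, ς⟩, rfl⟩ := finProdFinEquiv.surjective m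
  simp only [Equiv.symm_apply_apply]
  refine Fin.addCases (motive := fun a => Fin.append (fun i : Fin (k * 2) => Φ (g (finProdFinEquiv.symm i).1) (finProdFinEquiv.symm i).2)
        (fun i : Fin (j * 2) => Φ (g' (finProdFinEquiv.symm i).1) (finProdFinEquiv.symm i).2) (Fin.cast h (finProdFinEquiv (a, ς))) =
      Φ (Fin.append g g' a) ς) (fun i => ?_) (fun l => ?_) a
  · have hc : Fin.cast h (finProdFinEquiv (Fin.castAdd j i, ς)) = Fin.castAdd (j * 2) (finProdFinEquiv (i, ς)) :=
      Fin.ext (by simp)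
    rw [hc, Fin.append_left, Fin.append_left, Equiv.symm_apply_apply]
  · have hc : Fin.cast h (finProdFinEquiv (Fin.natAdd k l, ς)) = Fin.natAdd (k * 2) (finProdFinEquiv (l, ς)) :=
      Fin.ext (by simp; ring)
    rw [hc, Fin.append_right, Fin.append_right, Equiv.symm_apply_apply]

/-- Reading an `append (cons)` list at the inserted position. -/
theorem append_cons_apply_mid {α : Type*} {a b : ℕ} (p : Fin a → α) (c : α) (q : Fin b → α) (ha : a < a + b + 1) :
    (Fin.append (m := a) (n := b + 1) p (Fin.cons c q) : Fin (a + b + 1) → α) ⟨a, ha⟩ = c := by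
  have hi : (⟨a, ha⟩ : Fin (a + (b + 1))) = Fin.natAdd a (0 : Fin (b + 1)) := Fin.ext (by simp)
  rw [hi, Fin.append_right, Fin.cons_zero]

/-- Reading an `append (cons)` list off the inserted position = reading the list with the insertion removed. -/
theorem append_cons_apply_succAbove {α : Type*} {a b : ℕ} (p : Fin a → α) (c : α) (q : Fin b → α) (ha : a < a + b + 1)
    (m : Fin (a + b)) :
    (Fin.append (m := a) (n := b + 1) p (Fin.cons c q) : Fin (a + b + 1) → α) ((⟨a, ha⟩ : Fin (a + b + 1)).succAbove m) =
      Fin.append p q m := by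
  refine Fin.addCases (motive := fun m => (Fin.append (m := a) (n := b + 1) p (Fin.cons c q) : Fin (a + b + 1) → α)
      ((⟨a, ha⟩ : Fin (a + b + 1)).succAbove m) = Fin.append p q m) (fun i => ?_) (fun l => ?_) m
  · have hlt : (Fin.castAdd b i).castSucc < (⟨a, ha⟩ : Fin (a + b + 1)) := by
      rw [Fin.lt_def]; simp
    have hi : (Fin.castAdd b i).castSucc = (Fin.castAdd (b + 1) i : Fin (a + (b + 1))) := Fin.ext (by simp)
    rw [Fin.succAbove_of_castSucc_lt _ _ hlt, Fin.append_left, hi, Fin.append_left]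
  · have hle : (⟨a, ha⟩ : Fin (a + b + 1)) ≤ (Fin.natAdd a l).castSucc := by
      rw [Fin.le_def]; simp
    have hi : (Fin.natAdd a l).succ = (Fin.natAdd a l.succ : Fin (a + (b + 1))) := Fin.ext (by simp; ring)
    rw [Fin.succAbove_of_le_castSucc _ _ hle, Fin.append_right, hi, Fin.append_right, Fin.cons_succ]

/-- A constant list appended to a constant list is constant. -/
theorem append_const_const {α : Type*} {a b : ℕ} (c : α) (m : Fin (a + b)) :
    Fin.append (fun _ : Fin a => c) (fun _ : Fin b => c) m = c := by
  refine Fin.addCases (fun i => ?_) (fun l => ?_) m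
  · rw [Fin.append_left]
  · rw [Fin.append_right]

variable {L : ℕ} [NeZero L]

/-! ## The determinant identity -/

/-- **k3c5-p1's split-pair matrix minus the shift diagonal has the determinant of the before-rule matrix `Ẽ`.** -/
theorem det_splitPairMatrix_sub_diagonal_eq_det_beforeRule (β μ : ℝ) (σ σ' : Fin 2) (xe ye : TorusSite 2 L) (s : ℝ) {k j : ℕ}
    (f : Fin k → FermionTorus 2 L) (f' : Fin j → FermionTorus 2 L) (u : Fin k → ℝ) (u' : Fin j → ℝ) :
    (splitPairMatrix β (hubbardOneBody (fermionTorusGraph 2 L) 1 μ) (k * 2) (k * 2 + j * 2) (Nat.le_add_right _ _)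
                  (Fin.append (m := k * 2) (n := j * 2 + 1)
                    (fun m : Fin (k * 2) => creVec (hubbardOneBody (fermionTorusGraph 2 L) 1 μ) ((((u (finProdFinEquiv.symm m).1 : ℝ) : ℂ)) * -(β : ℂ))
                      (orb (f (finProdFinEquiv.symm m).1) (finProdFinEquiv.symm m).2))
                    (Fin.cons (creVec (hubbardOneBody (fermionTorusGraph 2 L) 1 μ) (((((β - s) / β : ℝ) : ℂ)) * -(β : ℂ)) (orb (FermionTorus.ofTorusSite xe) σ))
                      (fun m : Fin (j * 2) => creVec (hubbardOneBody (fermionTorusGraph 2 L) 1 μ)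
                        (((((β - s) / β + u' (finProdFinEquiv.symm m).1 : ℝ) : ℂ)) * -(β : ℂ))
                        (orb (f' (finProdFinEquiv.symm m).1) (finProdFinEquiv.symm m).2)) :
                        Fin (j * 2 + 1) → Orb (FermionTorus 2 L) → ℂ) : Fin (k * 2 + j * 2 + 1) → Orb (FermionTorus 2 L) → ℂ)
                  (Fin.cons (annVec (hubbardOneBody (fermionTorusGraph 2 L) 1 μ) 0 (orb (FermionTorus.ofTorusSite ye) σ'))
                    (Fin.append
                      (fun m : Fin (k * 2) => annVec (hubbardOneBody (fermionTorusGraph 2 L) 1 μ) ((((u (finProdFinEquiv.symm m).1 : ℝ) : ℂ)) * -(β : ℂ))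
                        (orb (f (finProdFinEquiv.symm m).1) (finProdFinEquiv.symm m).2))
                      (fun m : Fin (j * 2) => annVec (hubbardOneBody (fermionTorusGraph 2 L) 1 μ)
                        (((((β - s) / β + u' (finProdFinEquiv.symm m).1 : ℝ) : ℂ)) * -(β : ℂ))
                        (orb (f' (finProdFinEquiv.symm m).1) (finProdFinEquiv.symm m).2))) :
                      Fin (k * 2 + j * 2 + 1) → Orb (FermionTorus 2 L) → ℂ) -
                Matrix.diagonal (Fin.cons 0 (Fin.append (fun _ : Fin (k * 2) => ((1 / 2 : ℝ) : ℂ)) (fun _ : Fin (j * 2) => ((1 / 2 : ℝ) : ℂ))) :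
                  Fin (k * 2 + j * 2 + 1) → ℂ)).det =
      (Matrix.of (Fin.cases
          (Fin.cases
            (-(exp (-((0 : ℂ) • hubbardOneBody (fermionTorusGraph 2 L) 1 μ)) *
                (1 + exp (-((β : ℂ) • hubbardOneBody (fermionTorusGraph 2 L) 1 μ)))⁻¹ *
                exp (((((β - s) / β : ℝ) : ℂ) * -(β : ℂ)) • hubbardOneBody (fermionTorusGraph 2 L) 1 μ))
              (orb (FermionTorus.ofTorusSite ye) σ') (orb (FermionTorus.ofTorusSite xe) σ))
            (fun m' : Fin ((k + j) * 2) =>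
              if k ≤ ((finProdFinEquiv.symm m' : Fin (k + j) × Fin 2).1 : ℕ) then
                (exp (-((((Fin.append u (fun l => (β - s) / β + u' l) (finProdFinEquiv.symm m' : Fin (k + j) × Fin 2).1 : ℝ) : ℂ) *
                      -(β : ℂ)) • hubbardOneBody (fermionTorusGraph 2 L) 1 μ)) *
                    (1 + exp ((β : ℂ) • hubbardOneBody (fermionTorusGraph 2 L) 1 μ))⁻¹ *
                    exp (((((β - s) / β : ℝ) : ℂ) * -(β : ℂ)) • hubbardOneBody (fermionTorusGraph 2 L) 1 μ))
                  (orb (FermionTorus.ofTorusSite (FermionTorus.toTorusSite (Fin.append f f' (finProdFinEquiv.symm m' : Fin (k + j) × Fin 2).1)))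
                    (finProdFinEquiv.symm m' : Fin (k + j) × Fin 2).2) (orb (FermionTorus.ofTorusSite xe) σ)
              else
                -(exp (-((((Fin.append u (fun l => (β - s) / β + u' l) (finProdFinEquiv.symm m' : Fin (k + j) × Fin 2).1 : ℝ) : ℂ) *
                      -(β : ℂ)) • hubbardOneBody (fermionTorusGraph 2 L) 1 μ)) *
                    (1 + exp (-((β : ℂ) • hubbardOneBody (fermionTorusGraph 2 L) 1 μ)))⁻¹ *
                    exp (((((β - s) / β : ℝ) : ℂ) * -(β : ℂ)) • hubbardOneBody (fermionTorusGraph 2 L) 1 μ))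
                  (orb (FermionTorus.ofTorusSite (FermionTorus.toTorusSite (Fin.append f f' (finProdFinEquiv.symm m' : Fin (k + j) × Fin 2).1)))
                    (finProdFinEquiv.symm m' : Fin (k + j) × Fin 2).2) (orb (FermionTorus.ofTorusSite xe) σ)))
          (fun m : Fin ((k + j) * 2) => Fin.cases
            (-(exp (-((0 : ℂ) • hubbardOneBody (fermionTorusGraph 2 L) 1 μ)) *
                (1 + exp (-((β : ℂ) • hubbardOneBody (fermionTorusGraph 2 L) 1 μ)))⁻¹ *
                exp ((((Fin.append u (fun l => (β - s) / β + u' l) (finProdFinEquiv.symm m : Fin (k + j) × Fin 2).1 : ℝ) : ℂ) *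
                  -(β : ℂ)) • hubbardOneBody (fermionTorusGraph 2 L) 1 μ))
              (orb (FermionTorus.ofTorusSite ye) σ')
              (orb (FermionTorus.ofTorusSite (FermionTorus.toTorusSite (Fin.append f f' (finProdFinEquiv.symm m : Fin (k + j) × Fin 2).1)))
                (finProdFinEquiv.symm m : Fin (k + j) × Fin 2).2))
            (fun m' : Fin ((k + j) * 2) =>
              twoPointWordMatrix L β μ σ σ' xe ye (fun a => FermionTorus.toTorusSite (Fin.append f f' a)) (Fin.append u (fun l => (β - s) / β + u' l)) m.succ m'.succ)) :
          Fin ((k + j) * 2 + 1) → Fin ((k + j) * 2 + 1) → ℂ)).det := by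
  have hH : (hubbardOneBody (fermionTorusGraph 2 L) 1 μ).IsHermitian := isHermitian_hubbardOneBody _ 1 μ
  -- instance alignment for `ι`-generic closed forms (`LinearOrder.toDecidableEq` vs the synthesised instance on `Orb (FermionTorus 2 L)`)
  have hinstO : (LinearOrder.toDecidableEq : DecidableEq (Orb (FermionTorus 2 L))) = (by infer_instance) :=
    Subsingleton.elim _ _
  dsimp only [inferInstance] at hinstO
  have Hn : (k + j) * 2 = k * 2 + j * 2 := by ring
  have HN : (k + j) * 2 + 1 = k * 2 + j * 2 + 1 := by rw [Hn]
  -- the letter vectors as (time, orbital) lists by word position / by pair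
  have hF : (Fin.append (m := k * 2) (n := j * 2 + 1)
                    (fun m : Fin (k * 2) => creVec (hubbardOneBody (fermionTorusGraph 2 L) 1 μ) ((((u (finProdFinEquiv.symm m).1 : ℝ) : ℂ)) * -(β : ℂ))
                      (orb (f (finProdFinEquiv.symm m).1) (finProdFinEquiv.symm m).2))
                    (Fin.cons (creVec (hubbardOneBody (fermionTorusGraph 2 L) 1 μ) (((((β - s) / β : ℝ) : ℂ)) * -(β : ℂ)) (orb (FermionTorus.ofTorusSite xe) σ))
                      (fun m : Fin (j * 2) => creVec (hubbardOneBody (fermionTorusGraph 2 L) 1 μ)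
                        (((((β - s) / β + u' (finProdFinEquiv.symm m).1 : ℝ) : ℂ)) * -(β : ℂ))
                        (orb (f' (finProdFinEquiv.symm m).1) (finProdFinEquiv.symm m).2)) :
                        Fin (j * 2 + 1) → Orb (FermionTorus 2 L) → ℂ) : Fin (k * 2 + j * 2 + 1) → Orb (FermionTorus 2 L) → ℂ) =
      fun i => creVec (hubbardOneBody (fermionTorusGraph 2 L) 1 μ) ((Fin.append (m := k * 2) (n := j * 2 + 1) (fun m : Fin (k * 2) => (((u (finProdFinEquiv.symm m).1 : ℝ) : ℂ)) * -(β : ℂ)) (Fin.cons (((((β - s) / β : ℝ) : ℂ)) * -(β : ℂ)) (fun m : Fin (j * 2) => ((((β - s) / β + u' (finProdFinEquiv.symm m).1 : ℝ) : ℂ)) * -(β : ℂ))) : Fin (k * 2 + j * 2 + 1) → ℂ) i) ((Fin.append (m := k * 2) (n := j * 2 + 1) (fun m : Fin (k * 2) => orb (f (finProdFinEquiv.symm m).1) (finProdFinEquiv.symm m).2) (Fin.cons (orb (FermionTorus.ofTorusSite xe) σ) (fun m : Fin (j * 2) => orb (f' (finProdFinEquiv.symm m).1) (finProdFinEquiv.symm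 m).2)) : Fin (k * 2 + j * 2 + 1) → Orb (FermionTorus 2 L)) i) := by
    funext i
    refine Fin.addCases (m := k * 2) (n := j * 2 + 1) (fun m => ?_) (fun m => ?_) i
    · simp only [Fin.append_left]
    · refine Fin.cases ?_ (fun m' => ?_) m
      · simp only [Fin.append_right, Fin.cons_zero]
      · simp only [Fin.append_right, Fin.cons_succ]
  have hG : (Fin.cons (annVec (hubbardOneBody (fermionTorusGraph 2 L) 1 μ) 0 (orb (FermionTorus.ofTorusSite ye) σ'))
                    (Fin.append
                      (fun m : Fin (k * 2) => annVec (hubbardOneBody (fermionTorusGraph 2 L) 1 μ) ((((u (finProdFinEquiv.symm m).1 : ℝ) : ℂ)) * -(β : ℂ))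
                        (orb (f (finProdFinEquiv.symm m).1) (finProdFinEquiv.symm m).2))
                      (fun m : Fin (j * 2) => annVec (hubbardOneBody (fermionTorusGraph 2 L) 1 μ)
                        (((((β - s) / β + u' (finProdFinEquiv.symm m).1 : ℝ) : ℂ)) * -(β : ℂ))
                        (orb (f' (finProdFinEquiv.symm m).1) (finProdFinEquiv.symm m).2))) :
                      Fin (k * 2 + j * 2 + 1) → Orb (FermionTorus 2 L) → ℂ) =
      fun b => annVec (hubbardOneBody (fermionTorusGraph 2 L) 1 μ) ((Fin.cons (0 : ℂ) (Fin.append (fun m : Fin (k * 2) => (((u (finProdFinEquiv.symm m).1 : ℝ) : ℂ)) * -(β : ℂ)) (fun m : Fin (j * 2) => ((((β - s) / β + u' (finProdFinEquiv.symm m).1 : ℝ) : ℂ)) * -(β : ℂ))) : Fin (k * 2 + j * 2 + 1) → ℂ) b) ((Fin.cons (orb (FermionTorus.ofTorusSite ye) σ') (Fin.append (fun m : Fin (k * 2) => orb (f (finProdFinEquiv.symm m).1) (finProdFinEquiv.symm m).2) (fun m : Fin (j * 2) => orb (f' (finProdFinEquiv.symm m).1) (finProdFinEquiv.symm m).2))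 : Fin (k * 2 + j * 2 + 1) → Orb (FermionTorus 2 L)) b) := by
    funext b
    refine Fin.cases ?_ (fun m => ?_) b
    · simp only [Fin.cons_zero]
    · simp only [Fin.cons_succ]
      refine Fin.addCases (m := k * 2) (n := j * 2) (fun m' => ?_) (fun m' => ?_) m
      · simp only [Fin.append_left]
      · simp only [Fin.append_right]
  -- k3c5-p1's closed forms of the entries, instances aligned
  have e00 := splitPairMatrix_evolved_zero_zero hH β (k * 2) (k * 2 + j * 2) (Nat.le_add_right _ _)
    (Fin.append (m := k * 2) (n := j * 2 + 1) (fun m : Fin (k * 2) => orb (f (finProdFinEquiv.symm m).1) (finProdFinEquiv.symm m).2) (Fin.cons (orb (FermionTorus.ofTorusSite xe) σ) (fun m : Fin (j * 2) => orb (f' (finProdFinEquiv.symm m).1) (finProdFinEquiv.symm m).2)) : Fin (k * 2 + j * 2 + 1) → Orb (FermionTorus 2 L)) (Fin.append (m := k * 2) (n := j * 2 + 1) (fun m : Fin (k * 2) => (((u (finProdFinEquiv.symm m).1 : ℝ) : ℂ)) * -(β : ℂ)) (Fin.cons (((((β - s) / β : ℝ) : ℂ)) * -(β : ℂ)) (fun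 m : Fin (j * 2) => ((((β - s) / β + u' (finProdFinEquiv.symm m).1 : ℝ) : ℂ)) * -(β : ℂ))) : Fin (k * 2 + j * 2 + 1) → ℂ) (Fin.cons (orb (FermionTorus.ofTorusSite ye) σ') (Fin.append (fun m : Fin (k * 2) => orb (f (finProdFinEquiv.symm m).1) (finProdFinEquiv.symm m).2) (fun m : Fin (j * 2) => orb (f' (finProdFinEquiv.symm m).1) (finProdFinEquiv.symm m).2)) : Fin (k * 2 + j * 2 + 1) → Orb (FermionTorus 2 L)) (Fin.cons (0 : ℂ) (Fin.append (fun m : Fin (k * 2) => (((u (finProdFinEquiv.symm m).1 : ℝ) : ℂ)) * -(β : ℂ)) (fun m : Fin (j * 2) => ((((β - s) / β + u' (finProdFinEquiv.symm m).1 : ℝ) : ℂ)) * -(β : ℂ))) : Fin (k * 2 + j * 2 + 1) → ℂ)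
  have e0s := fun m' : Fin (k * 2 + j * 2) => splitPairMatrix_evolved_zero_succ hH β (k * 2) (k * 2 + j * 2) (Nat.le_add_right _ _)
    (Fin.append (m := k * 2) (n := j * 2 + 1) (fun m : Fin (k * 2) => orb (f (finProdFinEquiv.symm m).1) (finProdFinEquiv.symm m).2) (Fin.cons (orb (FermionTorus.ofTorusSite xe) σ) (fun m : Fin (j * 2) => orb (f' (finProdFinEquiv.symm m).1) (finProdFinEquiv.symm m).2)) : Fin (k * 2 + j * 2 + 1) → Orb (FermionTorus 2 L)) (Fin.append (m := k * 2) (n := j * 2 + 1) (fun m : Fin (k * 2) => (((u (finProdFinEquiv.symm m).1 : ℝ) : ℂ)) * -(β : ℂ)) (Fin.cons (((((β - s) / β : ℝ) : ℂ)) * -(β : ℂ)) (fun m : Fin (j * 2) => ((((β - s) / β + u' (finProdFinEquiv.symm m).1 : ℝ) : ℂ)) * -(β : ℂ))) : Fin (k * 2 + j * 2 + 1) → ℂ) (Fin.cons (orb (FermionTorus.ofTorusSite ye) σ') (Fin.append (fun m : Fin (k * 2) => orb (f (finProdFinEquiv.symm m).1) (finProdFinEquiv.symm m).2) (fun m : Fin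 (j * 2) => orb (f' (finProdFinEquiv.symm m).1) (finProdFinEquiv.symm m).2)) : Fin (k * 2 + j * 2 + 1) → Orb (FermionTorus 2 L)) (Fin.cons (0 : ℂ) (Fin.append (fun m : Fin (k * 2) => (((u (finProdFinEquiv.symm m).1 : ℝ) : ℂ)) * -(β : ℂ)) (fun m : Fin (j * 2) => ((((β - s) / β + u' (finProdFinEquiv.symm m).1 : ℝ) : ℂ)) * -(β : ℂ))) : Fin (k * 2 + j * 2 + 1) → ℂ) m'
  have es0 := fun m : Fin (k * 2 + j * 2) => splitPairMatrix_evolved_succ_zero hH β (k * 2) (k * 2 + j * 2) (Nat.le_add_right _ _)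
    (Fin.append (m := k * 2) (n := j * 2 + 1) (fun m : Fin (k * 2) => orb (f (finProdFinEquiv.symm m).1) (finProdFinEquiv.symm m).2) (Fin.cons (orb (FermionTorus.ofTorusSite xe) σ) (fun m : Fin (j * 2) => orb (f' (finProdFinEquiv.symm m).1) (finProdFinEquiv.symm m).2)) : Fin (k * 2 + j * 2 + 1) → Orb (FermionTorus 2 L)) (Fin.append (m := k * 2) (n := j * 2 + 1) (fun m : Fin (k * 2) => (((u (finProdFinEquiv.symm m).1 : ℝ) : ℂ)) * -(β : ℂ)) (Fin.cons (((((β - s) / β : ℝ) : ℂ)) * -(β : ℂ)) (fun m : Fin (j * 2) => ((((β - s) / β + u' (finProdFinEquiv.symm m).1 : ℝ) : ℂ)) * -(β : ℂ))) : Fin (k * 2 + j * 2 + 1) → ℂ) (Fin.cons (orb (FermionTorus.ofTorusSite ye) σ') (Fin.append (fun m : Fin (k * 2) => orb (f (finProdFinEquiv.symm m).1) (finProdFinEquiv.symm m).2) (fun m : Fin (j * 2) => orb (f' (finProdFinEquiv.symm m).1) (finProdFinEquiv.symm m).2)) : Fin (k * 2 + j * 2 + 1) → Orb (FermionTorus 2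 L)) (Fin.cons (0 : ℂ) (Fin.append (fun m : Fin (k * 2) => (((u (finProdFinEquiv.symm m).1 : ℝ) : ℂ)) * -(β : ℂ)) (fun m : Fin (j * 2) => ((((β - s) / β + u' (finProdFinEquiv.symm m).1 : ℝ) : ℂ)) * -(β : ℂ))) : Fin (k * 2 + j * 2 + 1) → ℂ) m
  have ess := fun m m' : Fin (k * 2 + j * 2) => splitPairMatrix_evolved_succ_succ hH β (k * 2) (k * 2 + j * 2) (Nat.le_add_right _ _)
    (Fin.append (m := k * 2) (n := j * 2 + 1) (fun m : Fin (k * 2) => orb (f (finProdFinEquiv.symm m).1) (finProdFinEquiv.symm m).2) (Fin.cons (orb (FermionTorus.ofTorusSite xe) σ) (fun m : Fin (j * 2) => orb (f' (finProdFinEquiv.symm m).1) (finProdFinEquiv.symm m).2)) : Fin (k * 2 + j * 2 + 1) → Orb (FermionTorus 2 L)) (Fin.append (m := k * 2) (n := j * 2 + 1) (fun m : Fin (k * 2) => (((u (finProdFinEquiv.symm m).1 : ℝ) : ℂ)) * -(β : ℂ)) (Fin.cons (((((β - s) / β : ℝ) : ℂ)) * -(β : ℂ)) (fun m : Fin (j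 * 2) => ((((β - s) / β + u' (finProdFinEquiv.symm m).1 : ℝ) : ℂ)) * -(β : ℂ))) : Fin (k * 2 + j * 2 + 1) → ℂ) (Fin.cons (orb (FermionTorus.ofTorusSite ye) σ') (Fin.append (fun m : Fin (k * 2) => orb (f (finProdFinEquiv.symm m).1) (finProdFinEquiv.symm m).2) (fun m : Fin (j * 2) => orb (f' (finProdFinEquiv.symm m).1) (finProdFinEquiv.symm m).2)) : Fin (k * 2 + j * 2 + 1) → Orb (FermionTorus 2 L)) (Fin.cons (0 : ℂ) (Fin.append (fun m : Fin (k * 2) => (((u (finProdFinEquiv.symm m).1 : ℝ) : ℂ)) * -(β : ℂ)) (fun m : Fin (j * 2) => ((((β - s) / β + u' (finProdFinEquiv.symm m).1 : ℝ) : ℂ)) * -(β : ℂ))) : Fin (k * 2 + j * 2 + 1) → ℂ) m m'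
  rw [hinstO] at e00 e0s es0 ess
  -- reindex along `Fin ((k+j)*2+1) ≃ Fin (k*2+j*2+1)`
  rw [hF, hG, ← Matrix.det_submatrix_equiv_self (finCongr HN)]
  congr 1
  ext i b
  have hcs : ∀ m : Fin ((k + j) * 2), Fin.cast HN m.succ = (Fin.cast Hn m).succ := fun m => Fin.ext (by simp)
  have hK2 : ∀ m : Fin ((k + j) * 2), (k ≤ ((finProdFinEquiv.symm m : Fin (k + j) × Fin 2).1 : ℕ)) ↔ k * 2 ≤ (m : ℕ) := fun m => by
    simp [finProdFinEquiv_symm_apply, Fin.coe_divNat, Nat.le_div_iff_mul_le]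
  have hTm : ∀ m : Fin ((k + j) * 2), Fin.append (fun m : Fin (k * 2) => (((u (finProdFinEquiv.symm m).1 : ℝ) : ℂ)) * -(β : ℂ)) (fun m : Fin (j * 2) => ((((β - s) / β + u' (finProdFinEquiv.symm m).1 : ℝ) : ℂ)) * -(β : ℂ)) (Fin.cast Hn m) =
      (((Fin.append u (fun l => (β - s) / β + u' l) (finProdFinEquiv.symm m : Fin (k + j) × Fin 2).1 : ℝ) : ℂ)) * -(β : ℂ) :=
    fun m => append_pairBlocks_cast u (fun l => (β - s) / β + u' l) (fun r (_ : Fin 2) => ((r : ℝ) : ℂ) * -(β : ℂ)) Hn m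
  have hOm : ∀ m : Fin ((k + j) * 2), Fin.append (fun m : Fin (k * 2) => orb (f (finProdFinEquiv.symm m).1) (finProdFinEquiv.symm m).2) (fun m : Fin (j * 2) => orb (f' (finProdFinEquiv.symm m).1) (finProdFinEquiv.symm m).2) (Fin.cast Hn m) =
      orb (Fin.append f f' (finProdFinEquiv.symm m : Fin (k + j) × Fin 2).1) (finProdFinEquiv.symm m : Fin (k + j) × Fin 2).2 :=
    fun m => append_pairBlocks_cast f f' (fun z ς => orb z ς) Hn m
  refine Fin.cases ?_ (fun m => ?_) i <;> refine Fin.cases ?_ (fun m' => ?_) b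
  · -- (0,0): the corner `⟨c_Y a⁺_X⟩`
    simp only [Matrix.submatrix_apply, finCongr_apply, Fin.cast_zero, Matrix.sub_apply, Matrix.of_apply, Fin.cases_zero]
    erw [e00]
    simp only [Matrix.diagonal_apply_eq, Fin.cons_zero, sub_zero, append_cons_apply_mid]
  · -- (0, m'+1): the X row
    simp only [Matrix.submatrix_apply, finCongr_apply, Fin.cast_zero, hcs, Matrix.sub_apply, Matrix.of_apply, Fin.cases_zero,
      Fin.cases_succ]
    erw [e0s]
    simp only [Fin.cons_succ, append_cons_apply_mid, hTm, hOm, Fin.val_cast, hK2,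
      Matrix.diagonal_apply_ne _ (Fin.succ_ne_zero _).symm, sub_zero, FermionTorus.ofTorusSite_toTorusSite]
  · -- (m+1, 0): the Y column
    simp only [Matrix.submatrix_apply, finCongr_apply, Fin.cast_zero, hcs, Matrix.sub_apply, Matrix.of_apply, Fin.cases_zero,
      Fin.cases_succ]
    erw [es0]
    simp only [Fin.cons_zero, append_cons_apply_succAbove, hTm, hOm, Matrix.diagonal_apply_ne _ (Fin.succ_ne_zero _), sub_zero,
      FermionTorus.ofTorusSite_toTorusSite]
  · -- (m+1, m'+1): the vertex block
    simp only [Matrix.submatrix_apply, finCongr_apply, hcs, Matrix.sub_apply, Matrix.of_apply, Fin.cases_succ]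
    erw [ess]
    simp only [Fin.cons_succ, append_cons_apply_succAbove, hTm, hOm, Matrix.diagonal_apply, Fin.succ_inj, Fin.cast_inj,
      Fin.cast_le_cast, append_const_const, twoPointWordMatrix_succ_succ, vacuumWordMatrix, propMatrix, Matrix.sub_apply,
      Matrix.of_apply, Matrix.smul_apply, Matrix.one_apply, smul_eq_mul, mul_ite, mul_one, mul_zero,
      FermionTorus.ofTorusSite_toTorusSite]

/-! ## `hC2` discharged, and (H1) -/

/-- **The pointwise hypothesis `hC2` of `hasSum_twoPointLimitDet_series_time_of_C2` holds**: for every configuration, the free trace of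
p484918's two-time word is `Z₀ · (−det Ẽ)` (k3c5-p1's `gibbsState_dGamma_twoTime_shiftedHubbardWord_eq_neg_det` and the determinant identity). -/
theorem trace_twoTimeWord_eq_partitionFn_mul_neg_det (β μ : ℝ) (σ σ' : Fin 2) (xe ye : TorusSite 2 L) (s : ℝ) {k j : ℕ}
    (u : Fin k → ℝ) (u' : Fin j → ℝ) (f : Fin k → FermionTorus 2 L) (f' : Fin j → FermionTorus 2 L) :
    (Matrix.gibbsWeight β (dGamma (hubbardOneBody (fermionTorusGraph 2 L) 1 μ)) * (annihilation (orb (FermionTorus.ofTorusSite ye) σ') *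
                ((List.ofFn fun i : Fin k =>
                    ((exp ((((u i : ℝ) : ℂ) * -(β : ℂ)) • dGamma (hubbardOneBody (fermionTorusGraph 2 L) 1 μ)) * creation (orb (f i) 0) *
                          exp (-((((u i : ℝ) : ℂ) * -(β : ℂ)) • dGamma (hubbardOneBody (fermionTorusGraph 2 L) 1 μ)))) *
                        (exp ((((u i : ℝ) : ℂ) * -(β : ℂ)) • dGamma (hubbardOneBody (fermionTorusGraph 2 L) 1 μ)) * annihilation (orb (f i) 0) *
                          exp (-((((u i : ℝ) : ℂ) * -(β : ℂ)) • dGamma (hubbardOneBody (fermionTorusGraph 2 L) 1 μ)))) -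
                      ((1 / 2 : ℝ) : ℂ) • (1 : Matrix (Finset (Orb (FermionTorus 2 L))) (Finset (Orb (FermionTorus 2 L))) ℂ)) *
                    ((exp ((((u i : ℝ) : ℂ) * -(β : ℂ)) • dGamma (hubbardOneBody (fermionTorusGraph 2 L) 1 μ)) * creation (orb (f i) 1) *
                          exp (-((((u i : ℝ) : ℂ) * -(β : ℂ)) • dGamma (hubbardOneBody (fermionTorusGraph 2 L) 1 μ)))) *
                        (exp ((((u i : ℝ) : ℂ) * -(β : ℂ)) • dGamma (hubbardOneBody (fermionTorusGraph 2 L) 1 μ)) * annihilation (orb (f i) 1) *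
                          exp (-((((u i : ℝ) : ℂ) * -(β : ℂ)) • dGamma (hubbardOneBody (fermionTorusGraph 2 L) 1 μ)))) -
                      ((1 / 2 : ℝ) : ℂ) • (1 : Matrix (Finset (Orb (FermionTorus 2 L))) (Finset (Orb (FermionTorus 2 L))) ℂ))).prod *
                  (exp (((((β - s) / β : ℝ) : ℂ) * -(β : ℂ)) • dGamma (hubbardOneBody (fermionTorusGraph 2 L) 1 μ)) * creation (orb (FermionTorus.ofTorusSite xe) σ) *
                    exp (-(((((β - s) / β : ℝ) : ℂ) * -(β : ℂ)) • dGamma (hubbardOneBody (fermionTorusGraph 2 L) 1 μ)))) *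
                  (List.ofFn fun l : Fin j =>
                    ((exp ((((((β - s) / β + u' l : ℝ) : ℂ)) * -(β : ℂ)) • dGamma (hubbardOneBody (fermionTorusGraph 2 L) 1 μ)) * creation (orb (f' l) 0) *
                          exp (-((((((β - s) / β + u' l : ℝ) : ℂ)) * -(β : ℂ)) • dGamma (hubbardOneBody (fermionTorusGraph 2 L) 1 μ)))) *
                        (exp ((((((β - s) / β + u' l : ℝ) : ℂ)) * -(β : ℂ)) • dGamma (hubbardOneBody (fermionTorusGraph 2 L) 1 μ)) *
                            annihilation (orb (f' l) 0) *
                          exp (-((((((β - s) / β + u' l : ℝ) : ℂ)) * -(β : ℂ)) • dGamma (hubbardOneBody (fermionTorusGraph 2 L) 1 μ)))) -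
                      ((1 / 2 : ℝ) : ℂ) • (1 : Matrix (Finset (Orb (FermionTorus 2 L))) (Finset (Orb (FermionTorus 2 L))) ℂ)) *
                    ((exp ((((((β - s) / β + u' l : ℝ) : ℂ)) * -(β : ℂ)) • dGamma (hubbardOneBody (fermionTorusGraph 2 L) 1 μ)) * creation (orb (f' l) 1) *
                          exp (-((((((β - s) / β + u' l : ℝ) : ℂ)) * -(β : ℂ)) • dGamma (hubbardOneBody (fermionTorusGraph 2 L) 1 μ)))) *
                        (exp ((((((β - s) / β + u' l : ℝ) : ℂ)) * -(β : ℂ)) • dGamma (hubbardOneBody (fermionTorusGraph 2 L) 1 μ)) *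
                            annihilation (orb (f' l) 1) *
                          exp (-((((((β - s) / β + u' l : ℝ) : ℂ)) * -(β : ℂ)) • dGamma (hubbardOneBody (fermionTorusGraph 2 L) 1 μ)))) -
                      ((1 / 2 : ℝ) : ℂ) • (1 : Matrix (Finset (Orb (FermionTorus 2 L))) (Finset (Orb (FermionTorus 2 L))) ℂ))).prod))).trace =
          Matrix.partitionFn β (dGamma (hubbardOneBody (fermionTorusGraph 2 L) 1 μ)) * -(Matrix.of (Fin.cases
          (Fin.cases
            (-(exp (-((0 : ℂ) • hubbardOneBody (fermionTorusGraph 2 L) 1 μ)) *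
                (1 + exp (-((β : ℂ) • hubbardOneBody (fermionTorusGraph 2 L) 1 μ)))⁻¹ *
                exp (((((β - s) / β : ℝ) : ℂ) * -(β : ℂ)) • hubbardOneBody (fermionTorusGraph 2 L) 1 μ))
              (orb (FermionTorus.ofTorusSite ye) σ') (orb (FermionTorus.ofTorusSite xe) σ))
            (fun m' : Fin ((k + j) * 2) =>
              if k ≤ ((finProdFinEquiv.symm m' : Fin (k + j) × Fin 2).1 : ℕ) then
                (exp (-((((Fin.append u (fun l => (β - s) / β + u' l) (finProdFinEquiv.symm m' : Fin (k + j) × Fin 2).1 : ℝ) : ℂ) *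
                      -(β : ℂ)) • hubbardOneBody (fermionTorusGraph 2 L) 1 μ)) *
                    (1 + exp ((β : ℂ) • hubbardOneBody (fermionTorusGraph 2 L) 1 μ))⁻¹ *
                    exp (((((β - s) / β : ℝ) : ℂ) * -(β : ℂ)) • hubbardOneBody (fermionTorusGraph 2 L) 1 μ))
                  (orb (FermionTorus.ofTorusSite (FermionTorus.toTorusSite (Fin.append f f' (finProdFinEquiv.symm m' : Fin (k + j) × Fin 2).1)))
                    (finProdFinEquiv.symm m' : Fin (k + j) × Fin 2).2) (orb (FermionTorus.ofTorusSite xe) σ)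
              else
                -(exp (-((((Fin.append u (fun l => (β - s) / β + u' l) (finProdFinEquiv.symm m' : Fin (k + j) × Fin 2).1 : ℝ) : ℂ) *
                      -(β : ℂ)) • hubbardOneBody (fermionTorusGraph 2 L) 1 μ)) *
                    (1 + exp (-((β : ℂ) • hubbardOneBody (fermionTorusGraph 2 L) 1 μ)))⁻¹ *
                    exp (((((β - s) / β : ℝ) : ℂ) * -(β : ℂ)) • hubbardOneBody (fermionTorusGraph 2 L) 1 μ))
                  (orb (FermionTorus.ofTorusSite (FermionTorus.toTorusSite (Fin.append f f' (finProdFinEquiv.symm m' : Fin (k + j) × Fin 2).1)))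
                    (finProdFinEquiv.symm m' : Fin (k + j) × Fin 2).2) (orb (FermionTorus.ofTorusSite xe) σ)))
          (fun m : Fin ((k + j) * 2) => Fin.cases
            (-(exp (-((0 : ℂ) • hubbardOneBody (fermionTorusGraph 2 L) 1 μ)) *
                (1 + exp (-((β : ℂ) • hubbardOneBody (fermionTorusGraph 2 L) 1 μ)))⁻¹ *
                exp ((((Fin.append u (fun l => (β - s) / β + u' l) (finProdFinEquiv.symm m : Fin (k + j) × Fin 2).1 : ℝ) : ℂ) *
                  -(β : ℂ)) • hubbardOneBody (fermionTorusGraph 2 L) 1 μ))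
              (orb (FermionTorus.ofTorusSite ye) σ')
              (orb (FermionTorus.ofTorusSite (FermionTorus.toTorusSite (Fin.append f f' (finProdFinEquiv.symm m : Fin (k + j) × Fin 2).1)))
                (finProdFinEquiv.symm m : Fin (k + j) × Fin 2).2))
            (fun m' : Fin ((k + j) * 2) =>
              twoPointWordMatrix L β μ σ σ' xe ye (fun a => FermionTorus.toTorusSite (Fin.append f f' a)) (Fin.append u (fun l => (β - s) / β + u' l)) m.succ m'.succ)) :
          Fin ((k + j) * 2 + 1) → Fin ((k + j) * 2 + 1) → ℂ)).det := by
  haveI : Nonempty (Finset (Orb (FermionTorus 2 L))) := ⟨∅⟩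
  have hinst : (LinearOrder.toDecidableEq : DecidableEq (FermionTorus 2 L)) = instDecidableEqLex (Fin 2 → Fin L) :=
    Subsingleton.elim _ _
  have hZ : Matrix.partitionFn β (dGamma (hubbardOneBody (fermionTorusGraph 2 L) 1 μ)) ≠ 0 :=
    (Matrix.partitionFn_pos β (isHermitian_dGamma (isHermitian_hubbardOneBody (fermionTorusGraph 2 L) 1 μ))).ne'
  have hw := gibbsState_dGamma_twoTime_shiftedHubbardWord_eq_neg_det (isHermitian_hubbardOneBody (fermionTorusGraph 2 L) 1 μ) β
    f (fun i => ((u i : ℝ) : ℂ) * -(β : ℂ)) f' (fun l => ((((β - s) / β + u' l : ℝ) : ℂ)) * -(β : ℂ)) (FermionTorus.ofTorusSite xe)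
    (FermionTorus.ofTorusSite ye) σ σ' (((((β - s) / β : ℝ) : ℂ)) * -(β : ℂ)) (fun _ => ((1 / 2 : ℝ) : ℂ))
  rw [hinst] at hw
  rw [Matrix.gibbsState_apply, det_splitPairMatrix_sub_diagonal_eq_det_beforeRule] at hw
  rw [← hw, mul_inv_cancel_left₀ hZ]

/-- **(H1), `HasSum` form, UNCONDITIONAL**: for `L ≥ 3`, `β > 0`, every real `U, μ`, spins `σ, σ'`, sites `xe, ye`, `0 < s < β`, the
two-point limit-determinant series at external times `(s, 0)` sums to `e^{−βU|Λ|/4}·Tr(e^{−(β−s)H′}c†_{x̄ₑσ}e^{−sH′}c_{ȳₑσ′})/Tr e^{−βdΓh}`. -/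
theorem hasSum_twoPointLimitDet_series_time (hL : 3 ≤ L) {β : ℝ} (hβ : 0 < β) (μ U : ℝ) (σ σ' : Fin 2) (xe ye : TorusSite 2 L)
    {s : ℝ} (hs0 : 0 < s) (hsβ : s < β) :
    HasSum (fun n : ℕ => ((-1 : ℂ) ^ n * ((n ! : ℂ))⁻¹) * ((U : ℂ) ^ n * ∑ x : Fin n → TorusSite 2 L,
        ∫ τ in Set.Icc (0 : Fin n → ℝ) (fun _ => β),
        (Matrix.of fun i j' : Fin (n * 2 + 1) =>
          vertexLimitEntry L β μ ((Fin.append x ![xe, ye] : Fin (n + 2) → TorusSite 2 L) (twoPointPlusEnum n σ i).1)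
            ((Fin.append x ![xe, ye] : Fin (n + 2) → TorusSite 2 L) (twoPointMinusEnum n σ' j').1)
            (twoPointPlusEnum n σ i).2 (twoPointMinusEnum n σ' j').2
            ((Fin.append τ ![s, 0] : Fin (n + 2) → ℝ) (twoPointMinusEnum n σ' j').1 -
              (Fin.append τ ![s, 0] : Fin (n + 2) → ℝ) (twoPointPlusEnum n σ i).1)).det))
      (((Real.exp (-(β * (U * (1 / 2 : ℝ) ^ 2 * Fintype.card (FermionTorus 2 L)))) : ℂ) *
          (Matrix.gibbsWeight (β - s) (hamiltonianWith (fermionTorusGraph 2 L) 1 U (μ + U * (1 / 2 : ℝ))) *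
              creation (orb (FermionTorus.ofTorusSite xe) σ) *
            (Matrix.gibbsWeight s (hamiltonianWith (fermionTorusGraph 2 L) 1 U (μ + U * (1 / 2 : ℝ))) *
              annihilation (orb (FermionTorus.ofTorusSite ye) σ'))).trace) /
        Matrix.partitionFn β (dGamma (hubbardOneBody (fermionTorusGraph 2 L) 1 μ))) :=
  hasSum_twoPointLimitDet_series_time_of_C2 hL hβ μ U σ σ' xe ye hs0 hsβ
    fun _ _ u u' _ _ _ _ f f' => trace_twoTimeWord_eq_partitionFn_mul_neg_det β μ σ σ' xe ye s u u' f f'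

/-- **(H1), clause form, UNCONDITIONAL** — one clause of the hypothesis `hH1` of k3c5-p2's `stub_vl_bound_of_H1` / `stub_vl_bound_V14_of_H1`:
`∫dμ_{C_M} ψ⁺_{(x,s)σ} ψ⁻_{(y,0)σ'} e^{−V} ⟶ e^{−βUL²/4}·Tr(e^{−(β−s)H′}c†_{x̄σ}e^{−sH′}c_{ȳσ′})/Tr e^{−βH₀}` as `M → ∞`. -/
theorem tendsto_twoPoint_hamiltonian (hL : 3 ≤ L) {β : ℝ} (hβ : 0 < β) (μ U : ℝ) (σ σ' : Fin 2) (xe ye : TorusSite 2 L)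
    {s : ℝ} (hs : s ∈ Set.Ioo (0 : ℝ) β) :
    Tendsto (fun M : ℕ => gaussExpect ℂ (hubbardCovariance L M β μ 0)
        (positionField L M β 0 σ xe s * positionField L M β 1 σ' ye 0 * grassmannExp (-(hubbardInteraction L M β U)))) atTop
      (𝓝 ((Real.exp (-(β * U / 4 * (L : ℝ) ^ 2)) : ℂ) *
          (Matrix.gibbsWeight (β - s) (hubbardTorusWith 2 L 1 U (μ + U / 2)) * creation (orb (FermionTorus.ofTorusSite xe) σ) *
            (Matrix.gibbsWeight s (hubbardTorusWith 2 L 1 U (μ + U / 2)) * annihilation (orb (FermionTorus.ofTorusSite ye) σ'))).trace /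
          Matrix.partitionFn β (hubbardTorusWith 2 L 1 0 μ))) :=
  tendsto_twoPoint_hamiltonian_of_C2 hL hβ μ U σ σ' xe ye hs
    fun _ _ u u' _ _ _ _ f f' => trace_twoTimeWord_eq_partitionFn_mul_neg_det β μ σ σ' xe ye s u u' f f'

/-- **(H1) — THE HYPOTHESIS `hH1` OF `stub_vl_bound_of_H1` / `stub_vl_bound_V14_of_H1` IN FULL** (every `β > 0`, real `U, μ`, `L ≥ 3`,
sites `x, y`, `s ∈ (0,β)`, spins `↑↑`): `stub_vl_bound` of the volume-limit child follows by k3c5-p2's closer. -/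
theorem twoPoint_H1 :
    ∀ β : ℝ, 0 < β → ∀ (U μ : ℝ) (L : ℕ) [NeZero L], 3 ≤ L → ∀ (x y : TorusSite 2 L), ∀ s ∈ Set.Ioo (0 : ℝ) β,
      Tendsto (fun M : ℕ => gaussExpect ℂ (hubbardCovariance L M β μ 0)
          (positionField L M β 0 0 x s * positionField L M β 1 0 y 0 * grassmannExp (-(hubbardInteraction L M β U)))) atTop
        (𝓝 ((Real.exp (-(β * U / 4 * (L : ℝ) ^ 2)) : ℂ) *
          (Matrix.gibbsWeight (β - s) (hubbardTorusWith 2 L 1 U (μ + U / 2)) * creation (orb (FermionTorus.ofTorusSite x) 0) *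
            (Matrix.gibbsWeight s (hubbardTorusWith 2 L 1 U (μ + U / 2)) * annihilation (orb (FermionTorus.ofTorusSite y) 0))).trace /
          Matrix.partitionFn β (hubbardTorusWith 2 L 1 0 μ))) :=
  fun _ hβ U μ _ _ hL x y _ hs => tendsto_twoPoint_hamiltonian hL hβ μ U 0 0 x y hs

end Summit.HubbardSuperconductivity.HubbardSuperconductivity.Theorems.MatsubaraAllU

end
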